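import Summits.RiemannHypothesis.RiemannHypothesis.Theorems.Splittings.RobinFiniteThetaRelMain
import HarnessLib

/-!
# RobinFiniteThetaLiftCore — gen 13 θ-CEILING LIFT, part 4/6 (R2a): the E-side core with `θ ≥ 4x/5` and `S² ≤ s` as hypotheses; its RH-free discharge beyond `10¹⁹`

Cell rh-split, seat rh-split-robin-finite g13 (card `cards/SPLIT-robin-finite.md` §20, «θ-CEILING LIFT WITH NO NEW INPUT»).
A use-site audit of the tree's exchange engine shows that above the `Q`-scale every `θ`-evaluation consumes only RELATIVE precision
— RH-free from the two named facts the engine already carries, Büthe 2018 Thm 2 (`x ≤ 10¹⁹`) and BKLNW 2021 §1.2 (`x ≥ 10¹⁹`) — except the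
E-side term `S²(x) = (θ(x) − x)²/(x² log x)`, which BKLNW bounds by `1.43641·10⁻⁹/log⁵x`.  Parts 1–6 re-read the engine accordingly: above
`2.5·10²²` NO Schoenfeld-form window, NO Büthe 2016, NO range condition `4.92·√(X/log X) ≤ T`; RH to height `T` enters only through the
zero side, and the budget acquires the `T`-independent S²-price `2.07·10⁻¹⁶·√X` (BKLNW ceiling `X ≲ 5.5·10³⁰`).

This part (0 `def`): `sq_theta_sub_div_le_free` (BKLNW: `S²(x) ≤ 1.43641·10⁻⁹/log⁵x`, `x ≥ 10¹⁹`), `corePwLowerS_of_stubs` (the tree's c = 1 core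
`corePwLower1_of_stubs` VERBATIM with the window replaced by the two local inputs `4x/5 ≤ θ(x)`, `S²(x) ≤ s`, the price `s − log³x/(64π²x)` explicit),
`partialNicolasBetweenS_holds` (the windowed E-side on `[X₀, X₁]`, `X₀ ≥ 10¹⁹`, NO window hypothesis).

HONEST LABEL: SPLITTING SEARCH over kernel-typed RH-EQUIVALENCES; a splitting A ∧ B ⟹ RH is CONDITIONAL
bookkeeping unless A and B are both proved; nothing here bears on the truth of RH.
-/

set_option linter.dupNamespace false

noncomputable section

namespace Summit.RiemannHypothesis.RiemannHypothesis.Theorems.Splittings.RobinFiniteC1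

section CoreS

open Complex Filter Set MeasureTheory Topology intervalIntegral
open scoped Real Chebyshev ComplexConjugate
open Literature.NumberTheory.LFunctions Literature.NumberTheory.DiophantineGeometry
open NicolasJ NicolasFz NicolasK NicolasJExplicit
open Summit.RiemannHypothesis.RiemannHypothesis.Theorems.Splittings.RobinFiniteE1c
open Summit.RiemannHypothesis.RiemannHypothesis.Theorems.Splittings.RobinFiniteE3

/-! ### R2a · the E-side core with the two local `θ`-inputs as hypotheses, and its RH-free discharge beyond `10¹⁹` -/

/-- **RH-free S²-bound beyond `10¹⁹`** (BKLNW 2021 §1.2, `k = 2`, hypothesis position): for `x ≥ 10¹⁹`,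
`(θ(x) − x)²/(x² log x) ≤ 1.43641·10⁻⁹/log⁵x` (`(3.79·10⁻⁵)² = 1.43641·10⁻⁹`). -/
theorem sq_theta_sub_div_le_free (h21 : BroadbentEtAl2021_theta_rel_1e19) {x : ℝ} (hx : (10 : ℝ) ^ 19 ≤ x) :
    (θ x - x) ^ 2 / (x ^ 2 * Real.log x) ≤ 1.43641e-9 / Real.log x ^ 5 := by
  have hx0 : 0 < x := lt_of_lt_of_le (by norm_num) hx
  have hlog : 0 < Real.log x := Real.log_pos (lt_of_lt_of_le (by norm_num) hx)
  have h1 := h21.abs_sub_lt hx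
  have h2 : (θ x - x) ^ 2 ≤ (3.79e-5 * x / Real.log x ^ 2) ^ 2 := by
    rw [← sq_abs]
    exact pow_le_pow_left₀ (abs_nonneg _) h1.le 2
  have e : (3.79e-5 * x / Real.log x ^ 2) ^ 2 * Real.log x ^ 5 = 1.43641e-9 * (x ^ 2 * Real.log x) := by
    field_simp
    ring
  rw [div_le_div_iff₀ (by positivity) (by positivity)]
  calc (θ x - x) ^ 2 * Real.log x ^ 5 ≤ (3.79e-5 * x / Real.log x ^ 2) ^ 2 * Real.log x ^ 5 :=
        mul_le_mul_of_nonneg_right h2 (by positivity)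
    _ = 1.43641e-9 * (x ^ 2 * Real.log x) := e

/-- R2 · c = 1 · **the core with the two local `θ`-inputs as HYPOTHESES** (gen 13; copy of `corePwLower1_of_stubs`): the window
entered only through `θ(x) ≥ 4x/5` and `S²(x) := (θ(x) − x)²/(x² log x) ≤ log³x/(64π²x)`; here both are hypotheses (`hθ45`, `hS2 : S²(x) ≤ s`)
and the conclusion carries the explicit price `s − log³x/(64π²x)` next to `Eb`. -/
theorem corePwLowerS_of_stubs
    (h1 : ∀ x : ℝ, 1 < x →
      Summable (fun ρ : Zeros ↦ (riemannZetaZeroOrder (ρ : ℂ) : ℂ) / (ρ : ℂ) * Fz (ρ : ℂ) x) ∧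
      ∃ L : ℝ, Tendsto (fun X : ℝ ↦ ∫ t in x..X, (ψ t - t) * w0 t) atTop (𝓝 L) ∧
        (-∑' ρ : Zeros, (riemannZetaZeroOrder (ρ : ℂ) : ℂ) / (ρ : ℂ) * Fz (ρ : ℂ) x).re
          - Real.log (2 * π) / (x * Real.log x) ≤ L)
    (h2 : ∀ T x D : ℝ, 1 < x → RiemannHypothesisUpTo T →
      (∑' ρ : RHWave0.riemannZetaNontrivialZeros,
        (if T < |(ρ : ℂ).im| then
          (riemannZetaZeroOrder (ρ : ℂ) : ℝ) * x ^ ((ρ : ℂ).re - 1 / 2) / (ρ : ℂ).im ^ 2 else 0) ≤ D) →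
      Summable (fun ρ : Zeros ↦ (riemannZetaZeroOrder (ρ : ℂ) : ℂ) / (ρ : ℂ) * Fz (ρ : ℂ) x) →
        -(0.0463 * (1 / (Real.sqrt x * Real.log x) + Dx x)
            + (1 + 2 / Real.log x) * D * (1 / (Real.sqrt x * Real.log x))) ≤
          (-∑' ρ : Zeros, (riemannZetaZeroOrder (ρ : ℂ) : ℂ) / (ρ : ℂ) * Fz (ρ : ℂ) x).re)
    (h4 : ∀ t : ℝ, 599 ≤ t → ψ t - θ t ≤ 1.021 * Real.sqrt t + 4 / 3 * t ^ ((1 : ℝ) / 3)) :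
    ∀ T x D s : ℝ, 599 ≤ x → 0 ≤ D → RiemannHypothesisUpTo T →
      4 / 5 * x ≤ θ x → (θ x - x) ^ 2 / (x ^ 2 * Real.log x) ≤ s →
      (∑' ρ : RHWave0.riemannZetaNontrivialZeros,
        (if T < |(ρ : ℂ).im| then
          (riemannZetaZeroOrder (ρ : ℂ) : ℝ) * x ^ ((ρ : ℂ).re - 1 / 2) / (ρ : ℂ).im ^ 2 else 0) ≤ D) →
      -Real.log (nicolasF x) ≤ (RobinAnalyticSharp.nicolasERH x +
        (0.0463 + (1 + 2 / Real.log x) * D - nicolasBeta) *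
          (1 / (√x * Real.log x) + 1 / (√x * Real.log x ^ 2) + 4 / (√x * Real.log x ^ 3))) +
        (s - Real.log x ^ 3 / (64 * π ^ 2 * x)) := by
  intro T x D s hx hD hT hθ45 hS2 hoff
  have hx1 : (1 : ℝ) < x := by linarith
  have hx0 : (0 : ℝ) < x := by linarith
  have hlx : 0 < Real.log x := Real.log_pos hx1
  have hsx : 0 < Real.sqrt x := Real.sqrt_pos.2 hx0
  have h21 := NicolasK.lemma21_lower (by linarith : (121 : ℝ) ≤ x) hθ45
  obtain ⟨hsum, L, hL, hZL⟩ := h1 x hx1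
  have hK := NicolasK.tendsto_integral_S_mul_w0 hx1
  have hJK : L - nicolasKInt x ≤ 1.021 * (Fz (1 / 2 : ℝ) x).re + 4 / 3 * (Fz (1 / 3 : ℝ) x).re := by
    refine le_of_tendsto (hL.sub hK) ?_
    filter_upwards [eventually_ge_atTop x] with X hX
    exact jk_partial_le hx1 hX (by norm_num) fun t ht ↦ h4 t (le_trans hx ht)
  have hZ := h2 T x D hx1 hT hoff hsum
  have hF2 := NicolasFz.Fhalf_le hx1
  have hF3 := NicolasFz.Fthird_le hx1
  obtain ⟨a₁, ha₁⟩ : ∃ a : ℝ, a = 1 / (Real.sqrt x * Real.log x) := ⟨_, rfl⟩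
  obtain ⟨a₂, ha₂⟩ : ∃ a : ℝ, a = 1 / (Real.sqrt x * Real.log x ^ 2) := ⟨_, rfl⟩
  obtain ⟨a₃, ha₃⟩ : ∃ a : ℝ, a = 1 / (Real.sqrt x * Real.log x ^ 3) := ⟨_, rfl⟩
  obtain ⟨a₅, ha₅⟩ : ∃ a : ℝ, a = 1 / (x ^ ((2 : ℝ) / 3) * Real.log x) := ⟨_, rfl⟩
  obtain ⟨P, hP⟩ : ∃ a : ℝ, a = (1 + 2 / Real.log x) * D := ⟨_, rfl⟩
  have hP0 : 0 ≤ P := by rw [hP]; positivity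
  have ha₁0 : 0 ≤ a₁ := by rw [ha₁]; positivity
  have ha₂0 : 0 ≤ a₂ := by rw [ha₂]; positivity
  have ha₃0 : 0 ≤ a₃ := by rw [ha₃]; positivity
  have hPa₁ : 0 ≤ P * a₁ := mul_nonneg hP0 ha₁0
  have hPa₂ : 0 ≤ P * a₂ := mul_nonneg hP0 ha₂0
  have hPa₃ : 0 ≤ P * a₃ := mul_nonneg hP0 ha₃0
  have eZ : -(0.0463 * (1 / (Real.sqrt x * Real.log x) + Dx x)
      + (1 + 2 / Real.log x) * D * (1 / (Real.sqrt x * Real.log x))) =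
      -0.0463 * a₁ - 0.0463 * a₂ - 0.1852 * a₃ - P * a₁ := by
    rw [ha₁, ha₂, ha₃, hP, NicolasJExplicit.Dx]
    field_simp
    ring
  have eF2 : 2 / (Real.sqrt x * Real.log x) - 2 / (Real.sqrt x * Real.log x ^ 2) +
      8 / (Real.sqrt x * Real.log x ^ 3) = 2 * a₁ - 2 * a₂ + 8 * a₃ := by
    rw [ha₁, ha₂, ha₃]; ring
  have eF3 : 3 / (2 * x ^ (2 / 3 : ℝ) * Real.log x) = 3 / 2 * a₅ := by
    rw [ha₅]; ring
  have eE : RobinAnalyticSharp.nicolasERH x +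
        (0.0463 + (1 + 2 / Real.log x) * D - nicolasBeta) *
          (1 / (√x * Real.log x) + 1 / (√x * Real.log x ^ 2) + 4 / (√x * Real.log x ^ 3)) =
      2.0883 * a₁ + (P * a₁) - 1.9957 * a₂ + (P * a₂) + 8.3532 * a₃ + 4 * (P * a₃)
        + Real.log (2 * π) / (x * Real.log x) + 2 * a₅ + Real.log x ^ 3 / (64 * π ^ 2 * x) := by
    rw [ha₁, ha₂, ha₃, ha₅, hP]
    unfold RobinAnalyticSharp.nicolasERH RobinAnalyticSharp.nicolasE
    ring
  rw [eZ] at hZ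
  rw [eF2] at hF2
  rw [eF3] at hF3
  rw [eE]
  linarith

/-- **R2a · THE E-SIDE BEYOND `10¹⁹` WITH NO WINDOW HYPOTHESIS.**  RH to height `T`, a uniform off-line bound `D ≥ 0` on
`[X₀, X₁]` with `X₀ ≥ 10¹⁹`, and the two RH-free `θ`-facts (Büthe 2018 Thm 2, BKLNW 2021 §1.2 — the SAME hypotheses the tree's
core already carries for `ψ − θ`) give, for every `x ∈ [X₀, X₁]`,
`−log f(x) ≤ Eb(0.0463 + (1 + 2/log X₀)·D) x + (1.43641·10⁻⁹/log⁵x − log³x/(64π²x))`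
(`θ(x) ≥ 0.975x ≥ 4x/5` by `theta_ge_975R`; `S²` by `sq_theta_sub_div_le_free`).  No Büthe 2016, no range condition. -/
theorem partialNicolasBetweenS_holds (hB : Buthe2018_thm2_theta) (hK : BroadbentEtAl2021_theta_rel_1e19)
    {T D X₀ X₁ : ℝ}
    (hoff : ∀ x : ℝ, X₀ ≤ x → x ≤ X₁ →
      ∑' ρ : RHWave0.riemannZetaNontrivialZeros,
        (if T < |(ρ : ℂ).im| then
          (riemannZetaZeroOrder (ρ : ℂ) : ℝ) * x ^ ((ρ : ℂ).re - 1 / 2) / (ρ : ℂ).im ^ 2 else 0) ≤ D)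
    (hD : 0 ≤ D) (hX₀ : (10 : ℝ) ^ 19 ≤ X₀) (hT : RiemannHypothesisUpTo T) :
    ∀ x : ℝ, X₀ ≤ x → x ≤ X₁ →
      -Real.log (nicolasF x) ≤ (RobinAnalyticSharp.nicolasERH x +
          (0.0463 + (1 + 2 / Real.log X₀) * D - nicolasBeta) *
            (1 / (√x * Real.log x) + 1 / (√x * Real.log x ^ 2) + 4 / (√x * Real.log x ^ 3))) +
        (1.43641e-9 / Real.log x ^ 5 - Real.log x ^ 3 / (64 * π ^ 2 * x)) := by
  intro x hx0 hx1
  have hx19 : (10 : ℝ) ^ 19 ≤ x := hX₀.trans hx0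
  have hx : (599 : ℝ) ≤ x := le_trans (by norm_num) hx19
  have hx15 : (2 : ℝ) ^ 15 ≤ x := le_trans (by norm_num) hx19
  have hθ45 : 4 / 5 * x ≤ θ x := by
    have := theta_ge_975R hB hK hx15
    linarith
  have h := corePwLowerS_of_stubs explicitFormulaFree_holds zeroSplitBound_holds (psiSubThetaFree_holds hB hK)
    T x D _ hx hD hT hθ45 (sq_theta_sub_div_le_free hK hx19) (hoff x hx0 hx1)
  have hX₀1 : (1 : ℝ) < X₀ := lt_of_lt_of_le (by norm_num) hX₀
  have hmono := nicolasEWith_mono (x := x) (by linarith) (budgetPw1_anti hD hX₀1 hx0)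
  linarith

end CoreS

end Summit.RiemannHypothesis.RiemannHypothesis.Theorems.Splittings.RobinFiniteC1

end
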